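import Literature.AlgebraicGeometry.Resolution.KrasnerHenselian
import Literature.AlgebraicGeometry.Resolution.HenselizationGeneratorApproximation
import Literature.AlgebraicGeometry.Resolution.Kuhlmann2019Lemma41
import Literature.AlgebraicGeometry.Resolution.Kuhlmann2019Lemma54Proofs
import Literature.AlgebraicGeometry.Resolution.SeparatingElementCriterion
import Literature.AlgebraicGeometry.Resolution.SeparablyClosedDensity
import Literature.AlgebraicGeometry.Resolution.HenselizationImmediateProofs
import Literature.AlgebraicGeometry.Resolution.HenselizationHenselian
import Literature.AlgebraicGeometry.Resolution.Kuhlmann2019Prop52Reduction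
import Mathlib.FieldTheory.SeparableDegree
import HarnessLib

/-!
# Kuhlmann–Vlahu 2014, Thm. 11.1 as used in Kuhlmann 2019, Prop. 5.2: the generator can be taken in `F`

Topic: `Literature/AlgebraicGeometry/Resolution` (valued function fields). We PROVE the second
hypothesis `(hKV)` of `Kuhlmann2019_Prop52_sepClosed.of_degreeP_steps`
(`Kuhlmann2019Prop52Reduction.lean`), i.e. the use of F.-V. Kuhlmann, I. Vlahu, *The relative
approximation degree in valued function fields*, Math. Z. 276 (2014) 203–235 =
arXiv:1304.0200, **Thm. 11.1** in the proof of F.-V. Kuhlmann, *Elimination of ramification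
II: Henselian rationality*, Israel J. Math. 234 (2019) = arXiv:1701.05508, **Prop. 5.2**
("Now [23, Theorem 11.1] shows that `y` can already be chosen in `F`"):

> **Theorem 11.1.** Take a valued field `(K,v)` of rank 1 and an immediate function field
> `(F|K,v)` of transcendence degree 1. Suppose there is some `x ∈ F^h ∖ K^c` with
> transcendental approximation type over `K` such that `F^h = K(x)^h`. Then there is already
> some `y ∈ F` such that `F^h = K(y)^h`. In fact, there is some `γ ∈ vK` such that
> `K(x)^h = K(y)^h` holds for every `y ∈ F` with `v(x-y) ≥ γ`.
> *Proof.* Since `x ∉ K^c` there is `γ ∈ vK` such that `γ > dist(x,K)`. By assumption, the rank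
> of `(K,v)` is 1, and since `(F|K,v)` is immediate, also `(F,v)` has rank 1. Thus, the element
> `x` lies in the completion of `F`. So we may take some `y ∈ F` such that
> `v(x-y) ≥ γ > dist(x,K)`. For every such `y`, `[K(x)^h:K(y)^h] ≤ 𝐡_K(x:y)` holds by Theorem
> 10.7, and `𝐡_K(x:y) = 𝐡_K(x:x) = 1` … This yields that `K(x)^h = K(y)^h`.

in the setting of Prop. 5.2 (`K` separable-algebraically closed of rank one, `F|K` finitely
and separably generated of transcendence degree `1`, immediate; `x ∈ F^h` transcendental with
`F ≤ K(x)^h`; there the transcendental approximation type is automatic, Knaf–Kuhlmann 2009,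
Lemma 2.16 = `kaplansky_condition_of_isSepClosed`). The degree bound of Thm. 10.7 in relative
approximation degree `1` is replaced by its two constituents, proved in the tree: the Newton
step `exists_mem_valuation_sub_le_of_taylor` (`HenselizationGeneratorApproximation.lean`; KV
Lemma 10.4 with `𝐡 = 1`), which approximates `x` from `K(y)^h`, and Krasner's lemma over the
henselian `K(y)^h` (`KrasnerHenselian.lean`), which then puts the separable `x` into `K(y)^h`
once `y` is a SEPARATING element of `F|K` close to `x`; the case `x ∈ K^c` excluded in Thm. 11.1
is Kuhlmann 2019, Thm. 2.3 (same Krasner argument: `x` is a limit of elements of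
`K ⊆ K(y)^h`). Separating elements close to `x` exist: `F` is dense in `F^h` (rank one,
`RankOneDensity.lean`), and for a separating `z` one of `y₀`, `y₀ + z` is separating (the
criterion `y ∉ K·F^p`, `SeparatingElementCriterion.lean`).

## Content (everything PROVED; no definition, no named fact)

* `mem_of_isSeparable_of_pow_ringExpChar_pow_mem`, `isSeparable_trans_subfield`,
  `transcendental_of_forall_valuation_sub_lt`, `separating_or_separating_add`,
  `closure_insert_mul_eq` — bookkeeping on separating and transcendental elements.
* `kuhlmannVlahu_thm111` — **the hypothesis `(hKV)` of
  `Kuhlmann2019_Prop52_sepClosed.of_degreeP_steps`, verbatim**.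
* `Kuhlmann2019_Prop52_sepClosed.of_degreeP_step` — hence Prop. 5.2 (the named fact
  `Kuhlmann2019_Prop52_sepClosed`) from `(hstep)` = Props. 4.8/4.9 ALONE: its remaining trust
  base along the printed proof.

## Sources

* [KV14] F.-V. Kuhlmann, I. Vlahu, Math. Z. 276 (2014) = arXiv:1304.0200: §10 (Lemmas
  10.1–10.4, Prop. 10.5, Thm. 10.7), §11 (Thm. 11.1).
* [K19] F.-V. Kuhlmann, Israel J. Math. 234 (2019) = arXiv:1701.05508: Thm. 2.3, Lemma 4.1,
  Prop. 5.2, Lemma 5.4. [Kuhlmann2019]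
* [KK09] H. Knaf, F.-V. Kuhlmann, Adv. Math. 221 (2009): Lemmas 2.16–2.18. [KnafKuhlmann2009]
-/

noncomputable section

open IsLocalRing Polynomial

namespace Literature.AlgebraicGeometry.Resolution

universe u

variable {Ω : Type u} [Field Ω]

/-! ### Bookkeeping: separable, transcendental and separating elements -/

section Bookkeeping

/-- A separable element over the subfield `E` some `p^n`-th power of which lies in `E` lies in
`E` (`p` the characteristic exponent). [folklore] -/
theorem mem_of_isSeparable_of_pow_ringExpChar_pow_mem (E : Subfield Ω) {x : Ω}
    (hsep : IsSeparable E x) {n : ℕ} (hx : x ^ (ringExpChar Ω) ^ n ∈ E) : x ∈ E := by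
  haveI : ExpChar E (ringExpChar Ω) := by
    rw [← ringExpChar_subfield_eq E]; exact ringExpChar.expChar E
  have h1 : x ∈ separableClosure E Ω := mem_separableClosure_iff.mpr hsep
  have h2 : x ∈ perfectClosure E Ω := by
    rw [mem_perfectClosure_iff_pow_mem (ringExpChar Ω)]
    exact ⟨n, ⟨x ^ (ringExpChar Ω) ^ n, hx⟩, rfl⟩
  have h3 : x ∈ separableClosure E Ω ⊓ perfectClosure E Ω := IntermediateField.mem_inf.mpr ⟨h1, h2⟩
  rw [separableClosure_inf_perfectClosure, IntermediateField.mem_bot] at h3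
  obtain ⟨c, hc⟩ := h3
  rw [← hc]
  exact c.2

/-- Separability along a tower of subfields `E ≤ F ≤ Ω`: if every element of `F` is separable
over `E` and `x` is separable over `F`, then `x` is separable over `E`. [folklore] -/
theorem isSeparable_trans_subfield {E F : Subfield Ω} (hEF : E ≤ F)
    (hF : ∀ w ∈ F, IsSeparable E w) {x : Ω} (hx : IsSeparable F x) : IsSeparable E x := by
  letI : Algebra E F := (Subfield.inclusion hEF).toAlgebra
  haveI : IsScalarTower E F Ω := IsScalarTower.of_algebraMap_eq fun _ => rfl
  haveI : Algebra.IsSeparable E F := ⟨fun w => by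
    have h := hF w w.2
    unfold IsSeparable at h ⊢
    rwa [← minpoly.algebraMap_eq (algebraMap F Ω).injective w]⟩
  exact IsSeparable.of_algebra_isSeparable_of_isSeparable E hx

variable (V : ValuationSubring Ω)

/-- **Elements of `F` closer to `x` than `K` are transcendental** (for `K` separably closed and
`F` separable over `K(z)`, `z` transcendental): an algebraic `y ∈ F` is purely inseparable over
`K`, hence lies in `K(z)` (being separable over it), hence in `K` — but no element `c` of `K`
has `v(x - c) < v(x - c)`. [folklore] -/
theorem transcendental_of_forall_valuation_sub_lt {K F : Subfield Ω} [IsSepClosed K] {z : Ω}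
    (hz : Transcendental K z)
    (hsepz : ∀ b ∈ F, IsSeparable (Subfield.closure ((K : Set Ω) ∪ {z})) b) {x y : Ω}
    (hyF : y ∈ F) (hfar : ∀ c ∈ K, V.valuation (x - y) < V.valuation (x - c)) :
    Transcendental K y := by
  intro hyalg
  obtain ⟨n, hn⟩ := exists_pow_ringExpChar_mem_of_isAlgebraic K hyalg
  set Kz : Subfield Ω := Subfield.closure ((K : Set Ω) ∪ {z})
  have hKKz : K ≤ Kz := fun c hc => Subfield.subset_closure (Or.inl hc)
  have hyKz : y ∈ Kz := mem_of_isSeparable_of_pow_ringExpChar_pow_mem Kz (hsepz y hyF) (hKKz hn)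
  have hyK : y ∈ K := by
    by_contra hyK
    exact transcendental_of_mem_closure K hz hyKz hyK hyalg
  exact lt_irrefl _ (hfar y hyK)

/-- `K(az) = K(z)` for `a ∈ K^×`. [folklore] -/
theorem closure_insert_mul_eq (K : Subfield Ω) {a : Ω} (haK : a ∈ K) (ha0 : a ≠ 0) (z : Ω) :
    Subfield.closure ((K : Set Ω) ∪ {a * z}) = Subfield.closure ((K : Set Ω) ∪ {z}) := by
  apply le_antisymm
  · rw [Subfield.closure_le]
    rintro w (hw | hw)
    · exact Subfield.subset_closure (Or.inl hw)
    · rw [Set.mem_singleton_iff] at hw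
      subst hw
      exact mul_mem (Subfield.subset_closure (Or.inl haK)) (Subfield.subset_closure (Or.inr rfl))
  · rw [Subfield.closure_le]
    rintro w (hw | hw)
    · exact Subfield.subset_closure (Or.inl hw)
    · rw [Set.mem_singleton_iff] at hw
      subst hw
      have hmem : a⁻¹ * (a * w) ∈ Subfield.closure ((K : Set Ω) ∪ {a * w}) :=
        mul_mem (inv_mem (Subfield.subset_closure (Or.inl haK)))
          (Subfield.subset_closure (Or.inr rfl))
      rwa [← mul_assoc, inv_mul_cancel₀ ha0, one_mul] at hmem

/-- **One of `y₀`, `y₀ + z` is a separating element** (characteristic `p`): for a separating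
transcendental `z ∈ F` of the finitely generated `F|K` and transcendental `y₀, y₀ + z ∈ F`, the
criterion "`y` separating iff `y ∉ K·F^p`" (`SeparatingElementCriterion.lean`) applies to one
of them, since `z = (y₀ + z) - y₀ ∉ K·F^p`. [folklore] -/
theorem separating_or_separating_add (p : ℕ) [Fact p.Prime] [CharP Ω p] {K F : Subfield Ω}
    (hKF : K ≤ F) (hfg : FGOver K F) {z : Ω} (hz : Transcendental K z) (hzF : z ∈ F)
    (hsepz : ∀ b ∈ F, IsSeparable (Subfield.closure ((K : Set Ω) ∪ {z})) b) {y₀ : Ω}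
    (hy₀F : y₀ ∈ F) (hy₀t : Transcendental K y₀) (hy₁t : Transcendental K (y₀ + z)) :
    (∀ w ∈ F, IsSeparable (Subfield.closure ((K : Set Ω) ∪ {y₀})) w) ∨
      (∀ w ∈ F, IsSeparable (Subfield.closure ((K : Set Ω) ∪ {y₀ + z})) w) := by
  set C : Subfield Ω := Subfield.closure ((K : Set Ω) ∪ frobenius Ω p '' (F : Set Ω))
  have hzC : z ∉ C := not_mem_compositumPow_of_separating (p := p) hz hsepz
  by_cases hy₀C : y₀ ∈ C
  · right
    have hy₁C : y₀ + z ∉ C := fun h => hzC (by simpa using C.sub_mem h hy₀C)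
    exact isSeparable_adjoin_of_not_mem_compositumPow (p := p) hKF hfg hz hzF hsepz
      (add_mem hy₀F hzF) hy₁t hy₁C
  · left
    exact isSeparable_adjoin_of_not_mem_compositumPow (p := p) hKF hfg hz hzF hsepz hy₀F hy₀t hy₀C

end Bookkeeping

/-! ### The theorem -/

section Main

variable (V : ValuationSubring Ω)

/-- **Kuhlmann–Vlahu 2014, Thm. 11.1, as used in Kuhlmann 2019, Prop. 5.2** — the hypothesis
`(hKV)` of `Kuhlmann2019_Prop52_sepClosed.of_degreeP_steps`, verbatim: for `K` separably
closed of rank one, `F|K` finitely and separably generated of transcendence degree `1` and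
immediate, and `x ∈ F^h` transcendental over `K` with `F ≤ K(x)^h`, there is a transcendental
`y ∈ F` with `F ≤ K(y)^h`. PROVED: choose `y ∈ F` separating (and, if `x ∉ K^c`, closer to `x`
than `K`); then `x` is separable over the henselian `K(y)^h` and is a limit of elements of
`K(y)^h` (Newton step, resp. `x ∈ K^c`), hence `x ∈ K(y)^h` by Krasner's lemma, and
`F ≤ K(x)^h ≤ K(y)^h`. [cite: Kuhlmann2019, Prop. 5.2 (proof) with Thm. 2.3] -/
theorem kuhlmannVlahu_thm111 [IsAlgClosed Ω] (K F : Subfield Ω) (x : Ω) (hK : IsSepClosed K)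
    (hr : IsRankOne V K) (hKF : K ≤ F) (hfg : FGOver K F) (hsg : SeparablyGeneratedOver K F)
    (h1 : ∃ t ∈ F, Transcendental K t ∧
      ∀ z ∈ F, IsAlgebraic (IntermediateField.adjoin K ({t} : Set Ω)) z)
    (himm : IsImmediateOver V K F) (hxFh : x ∈ henselization V F) (hxt : Transcendental K x)
    (hFx : F ≤ henselization V (Subfield.closure ((K : Set Ω) ∪ {x}))) :
    ∃ y ∈ F, Transcendental K y ∧
      F ≤ henselization V (Subfield.closure ((K : Set Ω) ∪ {y})) := by
  classical
  haveI := hK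
  set Kx : Subfield Ω := Subfield.closure ((K : Set Ω) ∪ {x}) with hKxdef
  set Hx : Subfield Ω := henselization V Kx with hHxdef
  set Fh : Subfield Ω := henselization V F with hFhdef
  have hKKx : K ≤ Kx := fun c hc => Subfield.subset_closure (Or.inl hc)
  have hxKx : x ∈ Kx := Subfield.subset_closure (Or.inr rfl)
  have hFFh : F ≤ Fh := le_henselization V F
  have hKxFh : Kx ≤ Fh :=
    Subfield.closure_le.mpr (Set.union_subset (hKF.trans hFFh) (Set.singleton_subset_iff.mpr hxFh))
  -- immediateness of `F^h`, `K(x)` over `K`; rank one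
  have himmFh : IsImmediateOver V K Fh := himm.trans (Kuhlmann2010HenselizationImmediate_holds Ω V F)
  have himmKx : IsImmediateOver V K Kx := himmFh.mono_right hKxFh
  have hKr : IsRankOneValued V K := isRankOneValued_of_overrings V K hr.1 hr.2
  have hFr : IsRankOneValued V F := hKr.of_isImmediateOver hKF himm
  -- `x ∉ K`, immediateness data, transcendental approximation type
  have htrans : ∀ P : Polynomial Ω, (∀ k, P.coeff k ∈ K) → P.eval x = 0 → P = 0 := by
    intro P hP hPx
    obtain ⟨P', hP'⟩ : ∃ P' : Polynomial K, P'.map (algebraMap K Ω) = P :=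
      (Polynomial.mem_lifts P).mp ((Polynomial.lifts_iff_coeff_lifts P).mpr
        fun k => ⟨⟨P.coeff k, hP k⟩, rfl⟩)
    by_contra hP0
    refine hxt ⟨P', fun h => hP0 ?_, ?_⟩
    · rw [← hP', h, Polynomial.map_zero]
    · rw [Polynomial.aeval_def, ← Polynomial.eval_map, hP', hPx]
  have hxK : x ∉ K := not_mem_of_forall_eval_eq_zero K htrans
  have hval : ∀ w ∈ Kx, w ≠ 0 → ∃ b ∈ K, V.valuation w = V.valuation b := himmKx.1
  have hres : ∀ w ∈ Kx, w ∈ V → ∃ c ∈ K, V.valuation (w - c) < 1 := by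
    intro w hw hwV
    have hrw : residue V ⟨w, hwV⟩ ∈ resField V K := himmKx.2 (residue_mem_resField V ⟨w, hwV⟩ hw)
    obtain ⟨c, hcK, hcw⟩ := (mem_resField_iff V K _).mp hrw
    refine ⟨c, hcK, ?_⟩
    have h0 : residue V (⟨w, hwV⟩ - c) = 0 := by rw [map_sub, hcw, sub_self]
    exact (ValuationSubring.valuation_lt_one_iff V (⟨w, hwV⟩ - c)).mp ((residue_eq_zero_iff _).mp h0)
  have h3 := kaplansky_condition_of_isSepClosed V K htrans hval hres
  -- the valuation is non-trivial on `K`: some `π ∈ K^×` with `v(π) < 1`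
  obtain ⟨π, hπK, hπ0, hπ1⟩ : ∃ π ∈ K, π ≠ 0 ∧ V.valuation π < 1 := by
    obtain ⟨⟨a, haK, ha⟩, -⟩ := hKr
    have ha0 : a ≠ 0 := fun h => by rw [h, map_zero] at ha; exact not_lt_zero ha
    exact ⟨a⁻¹, inv_mem haK, inv_ne_zero ha0, by rw [map_inv₀]; exact inv_lt_one_of_one_lt₀ ha⟩
  -- a separating transcendental `z ∈ F`
  obtain ⟨z, hzF, hz, hsepz⟩ := exists_separating_of_separablyGeneratedOver hsg h1
  /- The core: for `y ∈ F` separating, transcendental, and — unless `x` is a limit of elements of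
  `K` — closer to `x` than `K`, we get `F ≤ K(y)^h`. -/
  have core : ∀ y ∈ F, Transcendental K y →
      (∀ w ∈ F, IsSeparable (Subfield.closure ((K : Set Ω) ∪ {y})) w) →
      ((∀ e ∈ K, e ≠ 0 → ∃ c ∈ K, V.valuation (x - c) < V.valuation e) ∨
        ∃ e ∈ K, e ≠ 0 ∧ (∀ c ∈ K, V.valuation e ≤ V.valuation (x - c)) ∧
          V.valuation (x - y) < V.valuation e) →
      F ≤ henselization V (Subfield.closure ((K : Set Ω) ∪ {y})) := by
    intro y hyF _hyt hsepy hcase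
    set Ky : Subfield Ω := Subfield.closure ((K : Set Ω) ∪ {y}) with hKydef
    set L : Subfield Ω := henselization V Ky with hLdef
    have hKKy : K ≤ Ky := fun c hc => Subfield.subset_closure (Or.inl hc)
    have hyKy : y ∈ Ky := Subfield.subset_closure (Or.inr rfl)
    have hKyF : Ky ≤ F :=
      Subfield.closure_le.mpr (Set.union_subset hKF (Set.singleton_subset_iff.mpr hyF))
    have hKyL : Ky ≤ L := le_henselization V Ky
    have hKL : K ≤ L := hKKy.trans hKyL
    have hL : IsHenselianField L (V.comap (algebraMap L Ω)) :=
      Kuhlmann2010HenselizationIsHenselian_holds Ω V Ky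
    have himmL : IsImmediateOver V Ky L := Kuhlmann2010HenselizationImmediate_holds Ω V Ky
    -- `x` is separable over `L`
    have hsepKy : IsSeparable Ky x :=
      isSeparable_trans_subfield hKyF hsepy (isSeparable_of_mem_henselization V F hxFh)
    have hsepL : IsSeparable L x := isSeparable_of_subfield_le hKyL hsepKy
    -- `x` is a limit of elements of `L`
    have happrox : ∀ e' ∈ L, e' ≠ 0 → ∃ ℓ ∈ L, V.valuation (x - ℓ) < V.valuation e' := by
      intro e' he'L he'0
      -- `e₁ ∈ K^×` with `v(e₁) = v(e')`
      obtain ⟨e₂, he₂Ky, he₂⟩ := himmL.1 e' he'L he'0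
      have he₂0 : e₂ ≠ 0 := fun h => he'0 (by
        rw [h, map_zero] at he₂; exact (Valuation.zero_iff _).mp he₂)
      obtain ⟨e₁, he₁K, he₁⟩ := himm.1 e₂ (hKyF he₂Ky) he₂0
      have he₁0 : e₁ ≠ 0 := fun h => he₂0 (by
        rw [h, map_zero] at he₁; exact (Valuation.zero_iff _).mp he₁)
      rw [he₂, he₁]
      rcases hcase with hA | ⟨e, heK, he0, hefar, hey⟩
      · obtain ⟨c, hcK, hc⟩ := hA e₁ he₁K he₁0
        exact ⟨c, hKL hcK, hc⟩
      · -- the Newton step: approximate `y` by `f(x)`, `f ∈ K[X]`, to within `min(v e, v e₁)`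
        obtain ⟨d, hdK, hd0, hde, hde₁⟩ : ∃ d ∈ K, d ≠ 0 ∧ V.valuation d ≤ V.valuation e ∧
            V.valuation d ≤ V.valuation e₁ := by
          by_cases h : V.valuation e₁ ≤ V.valuation e
          · exact ⟨e₁, he₁K, he₁0, h, le_rfl⟩
          · exact ⟨e, heK, he0, le_rfl, (not_le.mp h).le⟩
        obtain ⟨f, hf, hfy⟩ := exists_polynomial_valuation_sub_lt_of_isSepClosed V K hxt himmKx hr
          (hFx hyF) (hKKx hdK) hd0
        have hy' : ∀ c ∈ K, V.valuation (x - y) < V.valuation (x - c) := fun c hc =>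
          lt_of_lt_of_le hey (hefar c hc)
        have hfy' : ∀ c ∈ K, V.valuation (f.eval x - y) < V.valuation (x - c) := fun c hc => by
          rw [Valuation.map_sub_swap]
          exact lt_of_lt_of_le hfy (hde.trans (hefar c hc))
        obtain ⟨ℓ, hℓL, hℓ⟩ := exists_mem_valuation_sub_le_of_taylor V K hxK hval hres h3 hL hKL
          (hKyL hyKy) hy' hf hfy'
        refine ⟨ℓ, hℓL, lt_of_le_of_lt hℓ ?_⟩
        rw [Valuation.map_sub_swap]
        exact lt_of_lt_of_le hfy hde₁
    -- Krasner: `x ∈ L`; hence `K(x)^h ≤ L` and `F ≤ L`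
    have hxL : x ∈ L := mem_of_isHenselianField_of_forall_exists_valuation_sub_lt V hL hsepL happrox
    have hKxL : Kx ≤ L :=
      Subfield.closure_le.mpr (Set.union_subset hKL (Set.singleton_subset_iff.mpr hxL))
    have hHxL : Hx ≤ L := henselization_le_of_isHenselianField V Kx hKxL hL
    exact hFx.trans hHxL
  /- Case distinction: is `x` a limit of elements of `K`? -/
  by_cases hA : ∀ e ∈ K, e ≠ 0 → ∃ c ∈ K, V.valuation (x - c) < V.valuation e
  · exact ⟨z, hzF, hz, core z hzF hz hsepz (Or.inl hA)⟩
  push Not at hA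
  obtain ⟨e, heK, he0, hefar⟩ := hA
  -- `y₀ ∈ F` close to `x` (density of `F` in `F^h`) and a small separating `z₁ = a z`
  obtain ⟨y₀, hy₀F, hy₀⟩ := exists_mem_valuation_sub_lt_of_isRankOneValued hFr hxFh (hKF heK) he0
  have hz0 : z ≠ 0 := fun h => hz (h ▸ isAlgebraic_zero)
  obtain ⟨z', hz'K, hzz'⟩ := himm.1 z hzF hz0
  have hz'0 : z' ≠ 0 := fun h => hz0 (by
    rw [h, map_zero] at hzz'; exact (Valuation.zero_iff _).mp hzz')
  set a : Ω := e * z'⁻¹ * π with hadef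
  have haK : a ∈ K := mul_mem (mul_mem heK (inv_mem hz'K)) hπK
  have ha0 : a ≠ 0 := mul_ne_zero (mul_ne_zero he0 (inv_ne_zero hz'0)) hπ0
  set z₁ : Ω := a * z with hz₁def
  have hz₁F : z₁ ∈ F := mul_mem (hKF haK) hzF
  have hvz₁ : V.valuation z₁ < V.valuation e := by
    have hvz' : V.valuation z' ≠ 0 := (_root_.map_ne_zero _).mpr hz'0
    have : V.valuation z₁ = V.valuation e * V.valuation π := by
      rw [hz₁def, hadef, map_mul, map_mul, map_mul, map_inv₀, hzz']
      field_simp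
    rw [this]
    calc V.valuation e * V.valuation π < V.valuation e * 1 :=
          mul_lt_mul_of_pos_left hπ1 ((Valuation.pos_iff _).mpr he0)
      _ = V.valuation e := mul_one _
  have hz₁ : Transcendental K z₁ := by
    refine transcendental_of_mem_closure K hz ?_ fun hz₁K => ?_
    · exact mul_mem (Subfield.subset_closure (Or.inl haK)) (Subfield.subset_closure (Or.inr rfl))
    · have hzK : z ∈ K := by
        have : z = a⁻¹ * z₁ := by rw [hz₁def, ← mul_assoc, inv_mul_cancel₀ ha0, one_mul]
        rw [this]; exact mul_mem (inv_mem haK) hz₁K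
      exact hz (isAlgebraic_algebraMap (⟨z, hzK⟩ : K))
  have hsepz₁ : ∀ b ∈ F, IsSeparable (Subfield.closure ((K : Set Ω) ∪ {z₁})) b := by
    rw [hz₁def, closure_insert_mul_eq K haK ha0 z]
    exact hsepz
  -- both candidates `y₀`, `y₀ + z₁` are within `v(e)` of `x`, hence transcendental
  have hy₁ : V.valuation (x - (y₀ + z₁)) < V.valuation e := by
    have : x - (y₀ + z₁) = (x - y₀) + -z₁ := by ring
    rw [this]
    refine lt_of_le_of_lt (Valuation.map_add _ _ _) (max_lt hy₀ ?_)
    rw [Valuation.map_neg]; exact hvz₁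
  have hfar₀ : ∀ c ∈ K, V.valuation (x - y₀) < V.valuation (x - c) := fun c hc =>
    lt_of_lt_of_le hy₀ (hefar c hc)
  have hfar₁ : ∀ c ∈ K, V.valuation (x - (y₀ + z₁)) < V.valuation (x - c) := fun c hc =>
    lt_of_lt_of_le hy₁ (hefar c hc)
  have hy₀t : Transcendental K y₀ := transcendental_of_forall_valuation_sub_lt V hz hsepz hy₀F hfar₀
  have hy₁t : Transcendental K (y₀ + z₁) :=
    transcendental_of_forall_valuation_sub_lt V hz hsepz (add_mem hy₀F hz₁F) hfar₁
  -- one of them is separating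
  have hsep_or : (∀ w ∈ F, IsSeparable (Subfield.closure ((K : Set Ω) ∪ {y₀})) w) ∨
      (∀ w ∈ F, IsSeparable (Subfield.closure ((K : Set Ω) ∪ {y₀ + z₁})) w) := by
    obtain ⟨p, hcharp⟩ := CharP.exists Ω
    by_cases hp0 : p = 0
    · -- characteristic `0`: every transcendental element over which `F` is algebraic separates
      subst hp0
      haveI : CharZero Ω := CharP.charP_to_charZero Ω
      left
      intro w hw
      have halgz : ∀ b ∈ F, IsAlgebraic (Subfield.closure ((K : Set Ω) ∪ {z})) b :=
        fun b hb => (hsepz b hb).isIntegral.isAlgebraic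
      have halg₀ := isAlgebraic_closure_of_transcendental halgz hy₀F hy₀t
      have hint := (halg₀ w hw).isIntegral
      haveI : CharZero (Subfield.closure ((K : Set Ω) ∪ {y₀})) :=
        (Subfield.closure ((K : Set Ω) ∪ {y₀})).subtype.charZero
      exact PerfectField.separable_of_irreducible (minpoly.irreducible hint)
    · haveI : Fact p.Prime := ⟨CharP.char_prime_of_ne_zero Ω hp0⟩
      exact separating_or_separating_add p hKF hfg hz₁ hz₁F hsepz₁ hy₀F hy₀t hy₁t
  rcases hsep_or with hsep₀ | hsep₁
  · exact ⟨y₀, hy₀F, hy₀t, core y₀ hy₀F hy₀t hsep₀ (Or.inr ⟨e, heK, he0, hefar, hy₀⟩)⟩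
  · exact ⟨y₀ + z₁, add_mem hy₀F hz₁F, hy₁t,
      core (y₀ + z₁) (add_mem hy₀F hz₁F) hy₁t hsep₁ (Or.inr ⟨e, heK, he0, hefar, hy₁⟩)⟩

end Main

/-! ### Prop. 5.2 from the degree-`p` step alone -/

/-- **Kuhlmann 2019, Prop. 5.2 for a separably closed ground field, from Props. 4.8/4.9 alone**:
`Kuhlmann2019_Prop52_sepClosed.of_degreeP_steps` (`Kuhlmann2019Prop52Reduction.lean`) with its
second hypothesis `(hKV)` = [23, Thm. 11.1] discharged by `kuhlmannVlahu_thm111`. The hypothesis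
`(hstep)` is, verbatim as there, Props. 4.8/4.9 of the paper for a separable-algebraically closed
`K` of rank one. PROVED. [cite: Kuhlmann2019, Prop. 5.2] -/
theorem Kuhlmann2019_Prop52_sepClosed.of_degreeP_step
    (hstep : ∀ (Ω : Type u) [Field Ω] [IsAlgClosed Ω] (V : ValuationSubring Ω) (p : ℕ)
      [CharP (ResidueField V) p], p.Prime → ∀ (K : Subfield Ω) (y : Ω) (E : Subfield Ω),
      IsSepClosed K → IsRankOne V K → Transcendental K y →
      IsImmediateOver V K (Subfield.closure ((K : Set Ω) ∪ {y})) →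
      IsGaloisStep p (henselization V (Subfield.closure ((K : Set Ω) ∪ {y}))) E →
      ∃ ϑ ∈ E, E = henselization V (Subfield.closure ((K : Set Ω) ∪ {ϑ}))) :
    Kuhlmann2019_Prop52_sepClosed.{u} :=
  Kuhlmann2019_Prop52_sepClosed.of_degreeP_steps hstep
    fun _ _ _ V K F y hK hr hKF hfg hsg h1 himm hy hyt hF =>
      kuhlmannVlahu_thm111 V K F y hK hr hKF hfg hsg h1 himm hy hyt hF

end Literature.AlgebraicGeometry.Resolution

end
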